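import Summits.PneNP.PneNP.Theorems.SymmetryBudgetNoHiddenOrderPerPathCanon
import Literature.Combinatorics.SimpleGraph.OrderedRefinementEquiv

/-!
# The canonical copy is LABEL-INVARIANT (`NoHiddenOrder`, PER-PATH.md §12.2, brick B3 — invariance)

Route `PneNP/SymmetryBudget`, `NoHiddenOrder` (stmt-PneNP-14781). For the components-only Corneil–Goldberg canonical copy
`canon G A col : Enc` (`SymmetryBudgetNoHiddenOrderPerPathCanon.lean`; B. Laubner, PhD thesis HU Berlin 2011, §3.4) we prove
invariance along every isomorphism of coloured graphs: for an equivalence `e : W ≃ V` with `H.Adj a b ↔ G.Adj (e a) (e b)`, a block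
`B` of `W` carried onto the block `A` of `V`, and a colouring `col` of `V`,

  `canon H B (col ∘ e) = canon G A col` (`canon_equiv`; `canon_comap_perm` for a permutation of one vertex type).

Every ingredient of the recursion commutes with `e`: cells, block edge counts, the switching predicate and the switching graph
(`swComp_equiv`, `swAdj_equiv`), reachable sets (`swReach_equiv`), the colour-level switching data (`swCompC_equiv`), the first
smallest cell (`minCellCard_equiv`, `minColour_equiv`, `smallestCell_equiv`), refinement inside a block (`refineIn_equiv`, from
the Literature fact `ocrIter_equiv` on the induced subgraphs), individualisation (`indiv_equiv`), the colour read-back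
(`colMap_equiv`) and the termination measure (`canonMeasure_equiv`); the AND-step compares the SORTED lists of children copies
through their multisets, the OR-step the lex-least elements of equal candidate sets. Together with realisation
(`SymmetryBudgetNoHiddenOrderPerPathCanonRealise.lean`) this makes `canon` a canonical form of coloured blocks.
-/

-- `Summit.PneNP.PneNP.…` duplicates `PneNP` BY DESIGN (single-problem summit, D-0017 layout).
set_option linter.dupNamespace false

namespace Summit.PneNP.PneNP.Theorems

open Finset Literature.Combinatorics.SimpleGraph

namespace BranchSum

variable {V W : Type*} [DecidableEq V] [DecidableEq W] {G : SimpleGraph V} [DecidableRel G.Adj] {H : SimpleGraph W}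
  [DecidableRel H.Adj]

/-! ### Cells, blocks, switching along an equivalence -/

omit [DecidableEq V] [DecidableEq W] in
/-- Cells along `e`. -/
theorem mem_cellOf_equiv (e : W ≃ V) {A : Finset V} {B : Finset W} (hAB : ∀ w, w ∈ B ↔ e w ∈ A) (c : V → ℕ) (u w : W) :
    w ∈ cellOf B (c ∘ e) u ↔ e w ∈ cellOf A c (e u) := by
  rw [mem_cellOf_iff, mem_cellOf_iff, hAB]; rfl

omit [DecidableEq V] [DecidableEq W] in
/-- Cell sizes along `e`. -/
theorem card_cellOf_equiv (e : W ≃ V) {A : Finset V} {B : Finset W} (hAB : ∀ w, w ∈ B ↔ e w ∈ A) (c : V → ℕ) (u : W) :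
    (cellOf B (c ∘ e) u).card = (cellOf A c (e u)).card :=
  card_equiv e fun w => mem_cellOf_equiv e hAB c u w

omit [DecidableEq V] [DecidableEq W] in
/-- Block edge counts along `e`. -/
theorem blockEdges_equiv (e : W ≃ V) (hadj : ∀ a b, H.Adj a b ↔ G.Adj (e a) (e b)) {A : Finset V} {B : Finset W}
    (hAB : ∀ w, w ∈ B ↔ e w ∈ A) (c : V → ℕ) (u v : W) :
    blockEdges H B (c ∘ e) u v = blockEdges G A c (e u) (e v) := by
  unfold blockEdges
  refine card_equiv (Equiv.prodCongr e e) fun p => ?_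
  simp only [mem_filter, mem_product, Equiv.prodCongr_apply, Prod.map_fst, Prod.map_snd, mem_cellOf_equiv e hAB, hadj]

omit [DecidableEq V] [DecidableEq W] in
/-- The switching predicate along `e`. -/
theorem swComp_equiv (e : W ≃ V) (hadj : ∀ a b, H.Adj a b ↔ G.Adj (e a) (e b)) {A : Finset V} {B : Finset W}
    (hAB : ∀ w, w ∈ B ↔ e w ∈ A) (c : V → ℕ) (u v : W) :
    SwComp H B (c ∘ e) u v ↔ SwComp G A c (e u) (e v) := by
  unfold SwComp
  rw [card_cellOf_equiv e hAB, card_cellOf_equiv e hAB, blockEdges_equiv e hadj hAB]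

omit [DecidableEq V] [DecidableEq W] in
/-- Switching adjacency along `e`. -/
theorem swAdj_equiv (e : W ≃ V) (hadj : ∀ a b, H.Adj a b ↔ G.Adj (e a) (e b)) {A : Finset V} {B : Finset W}
    (hAB : ∀ w, w ∈ B ↔ e w ∈ A) (c : V → ℕ) (u v : W) :
    (swGraph H B (c ∘ e)).Adj u v ↔ (swGraph G A c).Adj (e u) (e v) := by
  rw [swGraph_adj, swGraph_adj, swComp_equiv e hadj hAB, hadj, e.injective.ne_iff]

/-- One expansion step along `e`. -/
theorem swExpand_equiv (e : W ≃ V) (hadj : ∀ a b, H.Adj a b ↔ G.Adj (e a) (e b)) {A : Finset V} {B : Finset W}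
    (hAB : ∀ w, w ∈ B ↔ e w ∈ A) (c : V → ℕ) {S : Finset V} {S' : Finset W} (hS : ∀ w, w ∈ S' ↔ e w ∈ S) (w : W) :
    w ∈ swExpand H B (c ∘ e) S' ↔ e w ∈ swExpand G A c S := by
  simp only [swExpand, mem_union, mem_filter]
  constructor
  · rintro (h | ⟨hw, a, ha, hab⟩)
    · exact Or.inl ((hS w).1 h)
    · exact Or.inr ⟨(hAB w).1 hw, e a, (hS a).1 ha, (swAdj_equiv e hadj hAB c a w).1 hab⟩
  · rintro (h | ⟨hw, a, ha, hab⟩)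
    · exact Or.inl ((hS w).2 h)
    · refine Or.inr ⟨(hAB w).2 hw, e.symm a, (hS _).2 (by simpa using ha), (swAdj_equiv e hadj hAB c _ _).2 ?_⟩
      simpa using hab

/-- Iterated expansion along `e`. -/
theorem iterate_swExpand_equiv (e : W ≃ V) (hadj : ∀ a b, H.Adj a b ↔ G.Adj (e a) (e b)) {A : Finset V} {B : Finset W}
    (hAB : ∀ w, w ∈ B ↔ e w ∈ A) (c : V → ℕ) {S : Finset V} {S' : Finset W} (hS : ∀ w, w ∈ S' ↔ e w ∈ S) (n : ℕ) :
    ∀ w, w ∈ (swExpand H B (c ∘ e))^[n] S' ↔ e w ∈ (swExpand G A c)^[n] S := by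
  induction n with
  | zero => exact hS
  | succ n ih =>
    intro w
    rw [Function.iterate_succ_apply', Function.iterate_succ_apply']
    exact swExpand_equiv e hadj hAB c ih w

/-- **Reachable sets along `e`.** -/
theorem swReach_equiv (e : W ≃ V) (hadj : ∀ a b, H.Adj a b ↔ G.Adj (e a) (e b)) {A : Finset V} {B : Finset W}
    (hAB : ∀ w, w ∈ B ↔ e w ∈ A) (c : V → ℕ) (u w : W) :
    w ∈ swReach H B (c ∘ e) u ↔ e w ∈ swReach G A c (e u) := by
  unfold swReach
  rw [card_equiv e hAB]
  refine iterate_swExpand_equiv e hadj hAB c (fun x => ?_) _ w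
  rw [mem_inter, mem_inter, mem_singleton, mem_singleton, hAB, e.apply_eq_iff_eq]

/-- Reachable sets along `e`, as mapped sets. -/
theorem map_swReach_equiv (e : W ≃ V) (hadj : ∀ a b, H.Adj a b ↔ G.Adj (e a) (e b)) {A : Finset V} {B : Finset W}
    (hAB : ∀ w, w ∈ B ↔ e w ∈ A) (c : V → ℕ) (u : W) :
    (swReach H B (c ∘ e) u).map e.toEmbedding = swReach G A c (e u) := by
  ext v
  rw [mem_map_equiv, swReach_equiv e hadj hAB, e.apply_symm_apply]

/-! ### Colour classes, colour-level switching data, the first smallest cell -/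

omit [DecidableEq V] [DecidableEq W] in
/-- Colour classes along `e`. -/
theorem mem_filter_col_equiv (e : W ≃ V) {A : Finset V} {B : Finset W} (hAB : ∀ w, w ∈ B ↔ e w ∈ A) (c : V → ℕ) (k : ℕ)
    (w : W) : (w ∈ B.filter fun x => (c ∘ e) x = k) ↔ e w ∈ A.filter fun x => c x = k := by
  rw [mem_filter, mem_filter, hAB]; rfl

omit [DecidableEq V] [DecidableEq W] in
/-- Colour class sizes along `e`. -/
theorem card_filter_col_equiv (e : W ≃ V) {A : Finset V} {B : Finset W} (hAB : ∀ w, w ∈ B ↔ e w ∈ A) (c : V → ℕ)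
    (k : ℕ) : (B.filter fun x => (c ∘ e) x = k).card = (A.filter fun x => c x = k).card :=
  card_equiv e (mem_filter_col_equiv e hAB c k)

omit [DecidableEq V] [DecidableEq W] in
/-- The colour sets agree. -/
theorem image_col_equiv (e : W ≃ V) {A : Finset V} {B : Finset W} (hAB : ∀ w, w ∈ B ↔ e w ∈ A) (c : V → ℕ) :
    B.image (c ∘ e) = A.image c := by
  ext k
  simp only [mem_image, Function.comp_apply]
  constructor
  · rintro ⟨w, hw, rfl⟩; exact ⟨e w, (hAB w).1 hw, rfl⟩
  · rintro ⟨v, hv, rfl⟩; exact ⟨e.symm v, (hAB _).2 (by simpa using hv), by simp⟩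

omit [DecidableEq V] [DecidableEq W] in
/-- The colour-level switching data agree. -/
theorem swCompC_equiv (e : W ≃ V) (hadj : ∀ a b, H.Adj a b ↔ G.Adj (e a) (e b)) {A : Finset V} {B : Finset W}
    (hAB : ∀ w, w ∈ B ↔ e w ∈ A) (c : V → ℕ) (k k' : ℕ) : SwCompC H B (c ∘ e) k k' ↔ SwCompC G A c k k' := by
  unfold SwCompC
  rw [card_filter_col_equiv e hAB c k, card_filter_col_equiv e hAB c k']
  have hE : (((B.filter fun x => (c ∘ e) x = k) ×ˢ (B.filter fun x => (c ∘ e) x = k')).filter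
      fun p => H.Adj p.1 p.2).card =
      (((A.filter fun x => c x = k) ×ˢ (A.filter fun x => c x = k')).filter fun p => G.Adj p.1 p.2).card := by
    refine card_equiv (Equiv.prodCongr e e) fun p => ?_
    simp only [mem_filter, mem_product, Equiv.prodCongr_apply, Prod.map_fst, Prod.map_snd, hadj, hAB,
      Function.comp_apply]
  rw [hE]

omit [DecidableEq V] [DecidableEq W] in
/-- The least cell size agrees. -/
theorem minCellCard_equiv (e : W ≃ V) {A : Finset V} {B : Finset W} (hAB : ∀ w, w ∈ B ↔ e w ∈ A) (c : V → ℕ) :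
    minCellCard B (c ∘ e) = minCellCard A c := by
  unfold minCellCard
  by_cases hB : B.Nonempty
  · have hA : A.Nonempty := by obtain ⟨w, hw⟩ := hB; exact ⟨e w, (hAB w).1 hw⟩
    rw [dif_pos hB, dif_pos hA]
    congr 1
    rw [image_col_equiv e hAB]
    exact image_congr fun k _ => card_filter_col_equiv e hAB c k
  · have hA : ¬ A.Nonempty := fun ⟨v, hv⟩ => hB ⟨e.symm v, (hAB _).2 (by simpa using hv)⟩
    rw [dif_neg hB, dif_neg hA]

omit [DecidableEq V] [DecidableEq W] in
/-- The colour of the first smallest cell agrees. -/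
theorem minColour_equiv (e : W ≃ V) {A : Finset V} {B : Finset W} (hAB : ∀ w, w ∈ B ↔ e w ∈ A) (c : V → ℕ) :
    minColour B (c ∘ e) = minColour A c := by
  have hset : ((B.image (c ∘ e)).filter fun k => (B.filter fun w => (c ∘ e) w = k).card = minCellCard B (c ∘ e)) =
      ((A.image c).filter fun k => (A.filter fun w => c w = k).card = minCellCard A c) := by
    rw [image_col_equiv e hAB, minCellCard_equiv e hAB]
    refine filter_congr fun k _ => ?_
    rw [card_filter_col_equiv e hAB c k]
  unfold minColour
  rw [hset]

omit [DecidableEq V] [DecidableEq W] in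
/-- **The first smallest cell along `e`.** -/
theorem smallestCell_equiv (e : W ≃ V) {A : Finset V} {B : Finset W} (hAB : ∀ w, w ∈ B ↔ e w ∈ A) (c : V → ℕ) (w : W) :
    w ∈ smallestCell B (c ∘ e) ↔ e w ∈ smallestCell A c := by
  unfold smallestCell
  rw [mem_filter, mem_filter, minColour_equiv e hAB, hAB]; rfl

/-! ### Refinement, individualisation, colour read-back, the measure -/

/-- **Refinement inside a block along `e`** (from `ocrIter_equiv` on the induced subgraphs). -/
theorem refineIn_equiv (e : W ≃ V) (hadj : ∀ a b, H.Adj a b ↔ G.Adj (e a) (e b)) {A : Finset V} {B : Finset W}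
    (hAB : ∀ w, w ∈ B ↔ e w ∈ A) (c : V → ℕ) : refineIn H B (c ∘ e) = refineIn G A c ∘ e := by
  funext w
  simp only [Function.comp_apply]
  by_cases hw : w ∈ B
  · have hw' : e w ∈ A := (hAB w).1 hw
    rw [refineIn_apply (c ∘ e) hw, refineIn_apply c hw']
    -- the induced equivalence of the two induced subgraphs
    let eB : ↥(B : Set W) ≃ ↥(A : Set V) := e.subtypeEquiv fun x => by rw [mem_coe, mem_coe]; exact hAB x
    have hadjB : ∀ a b : ↥(B : Set W), (H.induce (B : Set W)).Adj a b ↔ (G.induce (A : Set V)).Adj (eB a) (eB b) :=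
      fun a b => by simp only [SimpleGraph.induce_adj, hadj]; rfl
    have hcolB : (fun x : ↥(B : Set W) => (c ∘ e) x) = (fun x : ↥(A : Set V) => c x) ∘ eB := by funext x; rfl
    rw [hcolB, ocrIter_equiv eB hadjB, card_equiv e hAB]
    rfl
  · have hw' : e w ∉ A := fun h => hw ((hAB w).2 h)
    unfold refineIn
    rw [dif_neg hw, dif_neg hw']

/-- Individualisation along `e`. -/
theorem indiv_equiv (e : W ≃ V) (c : V → ℕ) (x : W) : indiv (c ∘ e) x = indiv c (e x) ∘ e := by
  funext w
  simp only [indiv, Function.comp_apply, e.apply_eq_iff_eq]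

omit [DecidableEq V] [DecidableEq W] in
/-- The colour read-back agrees. -/
theorem colMap_equiv (e : W ≃ V) {A : Finset V} {B : Finset W} (hAB : ∀ w, w ∈ B ↔ e w ∈ A) (cs c : V → ℕ) :
    colMap B (cs ∘ e) (c ∘ e) = colMap A cs c := by
  funext k
  unfold colMap
  congr 1
  ext m
  simp only [mem_image, mem_filter, Function.comp_apply]
  constructor
  · rintro ⟨w, ⟨hw, hk⟩, rfl⟩; exact ⟨e w, ⟨(hAB w).1 hw, hk⟩, rfl⟩
  · rintro ⟨v, ⟨hv, hk⟩, rfl⟩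
    exact ⟨e.symm v, ⟨(hAB _).2 (by simpa using hv), by simpa using hk⟩, by simp⟩

omit [DecidableEq V] [DecidableEq W] in
/-- The termination measure agrees. -/
theorem canonMeasure_equiv (e : W ≃ V) {A : Finset V} {B : Finset W} (hAB : ∀ w, w ∈ B ↔ e w ∈ A) (c : V → ℕ) :
    canonMeasure B (c ∘ e) = canonMeasure A c := by
  unfold canonMeasure
  rw [card_equiv e hAB, image_col_equiv e hAB]

/-! ### The canonical copy along an equivalence -/

/-- Lists over a finset read through `attach`, as multisets. -/
private theorem coe_toList_attach_map {α β : Type*} (s : Finset α) (g : α → β) :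
    ((s.attach.toList.map fun x => g x.1) : Multiset β) = s.val.map g := by
  rw [← Multiset.map_coe, coe_toList]
  have h : (s.val.attach.map Subtype.val).map g = s.val.map g := congrArg (Multiset.map g) (Multiset.attach_map_val s.val)
  rw [Multiset.map_map] at h
  exact h

/-- **LABEL INVARIANCE of the canonical copy.** Along an equivalence `e : W ≃ V` carrying `H` onto `G` and the block `B` onto
the block `A`, `canon H B (col ∘ e) = canon G A col`. -/
theorem canon_equiv (e : W ≃ V) (hadj : ∀ a b, H.Adj a b ↔ G.Adj (e a) (e b)) {A : Finset V} {B : Finset W}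
    (hAB : ∀ w, w ∈ B ↔ e w ∈ A) (col : V → ℕ) : canon H B (col ∘ e) = canon G A col := by
  suffices h : ∀ (n : ℕ) {A : Finset V} {B : Finset W}, (∀ w, w ∈ B ↔ e w ∈ A) → ∀ col : V → ℕ,
      canonMeasure A col = n → canon H B (col ∘ e) = canon G A col from h _ hAB col rfl
  intro n
  induction n using Nat.strong_induction_on with
  | _ n ih =>
  intro A B hAB col hn
  have hcard : B.card = A.card := card_equiv e hAB
  have hsc : (smallestCell B (col ∘ e)).card = (smallestCell A col).card := card_equiv e (smallestCell_equiv e hAB col)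
  have hANDiff : (∃ u ∈ B, swReach H B (col ∘ e) u ≠ B) ↔ (∃ u ∈ A, swReach G A col u ≠ A) := by
    constructor
    · rintro ⟨u, hu, hne⟩
      refine ⟨e u, (hAB u).1 hu, fun heqA => hne ?_⟩
      ext w
      rw [swReach_equiv e hadj hAB, heqA, hAB]
    · rintro ⟨v, hv, hne⟩
      refine ⟨e.symm v, (hAB _).2 (by simpa using hv), fun heqB => hne ?_⟩
      ext x
      have hx := swReach_equiv e hadj hAB col (e.symm v) (e.symm x)
      simp only [Equiv.apply_symm_apply] at hx
      rw [← hx, heqB, hAB, Equiv.apply_symm_apply]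
  rw [canon, canon]
  simp only [hcard, hsc, hANDiff]
  split_ifs with h1 hAND hOR
  · -- leaf
    rcases A.eq_empty_or_nonempty with rfl | hne
    · have hB : B = ∅ := eq_empty_iff_forall_notMem.2 fun w hw => by simpa using (hAB w).1 hw
      subst hB; simp
    · obtain ⟨a, rfl⟩ := card_eq_one.1 (le_antisymm h1 hne.card_pos)
      have hB : B = {e.symm a} := by
        ext w; rw [hAB, mem_singleton, mem_singleton, Equiv.eq_symm_apply]
      subst hB; simp [toList_singleton]
  · -- AND: same switching data; the sorted children copies agree as multisets
    have hsw : (fun k k' => decide (SwCompC H B (col ∘ e) k k')) = fun k k' => decide (SwCompC G A col k k') := by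
      funext k k'; rw [decide_eq_decide]; exact swCompC_equiv e hadj hAB col k k'
    rw [hsw]
    congr 1
    -- children: induction hypothesis on each component
    have hch : ∀ K' ∈ B.image fun u => swReach H B (col ∘ e) u,
        canon H K' (col ∘ e) = canon G (K'.map e.toEmbedding) col := by
      intro K' hK'
      obtain ⟨u, hu, rfl⟩ := mem_image.1 hK'
      have hKK : ∀ w, w ∈ swReach H B (col ∘ e) u ↔ e w ∈ (swReach H B (col ∘ e) u).map e.toEmbedding := fun w => by
        rw [mem_map_equiv, Equiv.symm_apply_apply]
      refine ih _ ?_ hKK col rfl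
      rw [← hn, map_swReach_equiv e hadj hAB]
      exact canonMeasure_lt_of_card_lt col col
        (card_swReach_lt_of_disconnected hAND (mem_image_of_mem _ ((hAB u).1 hu)))
    -- the two image sets correspond under `Finset.map e`
    have himg : (B.image fun u => swReach H B (col ∘ e) u).map (mapEmbedding e.toEmbedding).toEmbedding =
        A.image fun u => swReach G A col u := by
      ext K
      simp only [mem_map, mem_image, RelEmbedding.coe_toEmbedding, mapEmbedding_apply]
      constructor
      · rintro ⟨K', ⟨u, hu, rfl⟩, rfl⟩
        exact ⟨e u, (hAB u).1 hu, (map_swReach_equiv e hadj hAB col u).symm⟩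
      · rintro ⟨v, hv, rfl⟩
        refine ⟨swReach H B (col ∘ e) (e.symm v), ⟨e.symm v, (hAB _).2 (by simpa using hv), rfl⟩, ?_⟩
        rw [map_swReach_equiv e hadj hAB, Equiv.apply_symm_apply]
    apply List.Perm.eq_of_sortedLE List.sortedLE_insertionSort List.sortedLE_insertionSort
    refine ((List.perm_insertionSort _ _).trans ?_).trans (List.perm_insertionSort _ _).symm
    rw [← Multiset.coe_eq_coe]
    refine ((coe_toList_attach_map _ fun K => canon H K (col ∘ e)).trans ?_).trans
      (coe_toList_attach_map _ fun K => canon G K col).symm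
    rw [← himg, map_val, Multiset.map_map]
    refine Multiset.map_congr rfl fun K' hK' => ?_
    rw [Function.comp_apply, RelEmbedding.coe_toEmbedding, mapEmbedding_apply]
    exact hch K' hK'
  · -- OR: the candidate sets agree
    have hS : ∀ x' : {x // x ∈ smallestCell B (col ∘ e)}, e x'.1 ∈ smallestCell A col :=
      fun x' => (smallestCell_equiv e hAB col x'.1).1 x'.2
    have hF : ∀ x' : {x // x ∈ smallestCell B (col ∘ e)},
        recolour (colMap B (refineIn H B (indiv (col ∘ e) x'.1)) (col ∘ e)) (canon H B (refineIn H B (indiv (col ∘ e) x'.1))) =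
        recolour (colMap A (refineIn G A (indiv col (e x'.1))) col) (canon G A (refineIn G A (indiv col (e x'.1)))) := by
      rintro ⟨x', hx'⟩
      have hxA : e x' ∈ A := smallestCell_subset A col (hS ⟨x', hx'⟩)
      have h2 : 2 ≤ (cellOf A col (e x')).card := by rw [← smallestCell_eq_cellOf col (hS ⟨x', hx'⟩)]; exact hOR
      dsimp only
      rw [indiv_equiv e col x', refineIn_equiv e hadj hAB, colMap_equiv e hAB,
        ih _ (hn ▸ canonMeasure_lt_refineIn_indiv (G := G) col hxA h2) hAB _ rfl]
    have hsets : ((smallestCell B (col ∘ e)).attach.image fun x' =>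
        recolour (colMap B (refineIn H B (indiv (col ∘ e) x'.1)) (col ∘ e))
          (canon H B (refineIn H B (indiv (col ∘ e) x'.1)))) =
        (smallestCell A col).attach.image fun x =>
          recolour (colMap A (refineIn G A (indiv col x.1)) col) (canon G A (refineIn G A (indiv col x.1))) := by
      ext E
      simp only [mem_image, mem_attach, true_and, Subtype.exists]
      constructor
      · rintro ⟨x', hx', rfl⟩
        exact ⟨e x', hS ⟨x', hx'⟩, (hF ⟨x', hx'⟩).symm⟩
      · rintro ⟨x, hx, rfl⟩
        have hx' : e.symm x ∈ smallestCell B (col ∘ e) := (smallestCell_equiv e hAB col _).2 (by simpa using hx)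
        refine ⟨e.symm x, hx', ?_⟩
        rw [hF ⟨e.symm x, hx'⟩]
        simp only [Equiv.apply_symm_apply]
    congr 1
  · rfl

/-- **Label invariance under permutations of one vertex type**: for `σ : Equiv.Perm V`,
`canon (G.comap σ) (A.preimage σ σ.injective.injOn) (col ∘ σ) = canon G A col` (any adjacency decision procedure for the
relabelled graph). -/
theorem canon_comap_perm (σ : Equiv.Perm V) [DecidableRel (G.comap σ).Adj] (A : Finset V) (col : V → ℕ) :
    canon (G.comap σ) (A.preimage σ σ.injective.injOn) (col ∘ σ) = canon G A col :=
  canon_equiv (H := G.comap σ) σ (fun _ _ => Iff.rfl) (fun _ => mem_preimage) col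

end BranchSum

end Summit.PneNP.PneNP.Theorems
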